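import Summits.AtomisticToContinuum.HydrodynamicLimit.Theorems.JParityClosureParityBandClosurePressureValueDeterministic
import Summits.AtomisticToContinuum.HydrodynamicLimit.Theses.JParityClosure
import HarnessLib

/-!
# `EvenStressEnskog` + weak stress isotropy ⇒ the collisional pressure value (stub `stub_pressureValueOfEvenStress`)

Line `Sketch` of the crux `JParityClosure.ParityBandClosure` (stmt-AtomisticToContinuum-17608).  The configurational
input of the relative-energy Grönwall of the sister crux `ChaosClosesEuler` — the waypoint
`CollisionalPressureValueInBand` (the normalised collision functional of the stress mark
`g(σ³ρ_r(xᵢ))·|(vᵢ⁻ − vⱼ⁻)·n̂|·(n̂⊗n̂ : a(s, xᵢ))` minus `2∫₀ᵗ∫ g(σ³ρ_r)(p_hs(ρ_r, θ_r) − ρ_rθ_r) tr a` tends to `0` in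
probability) — follows from the route's crux `EvenStressEnskog` and the weak stress isotropy `WeakStressIsotropyInBand`
by EXACT algebra:

1. (part B, `cpvCollision_eq_sum`) on the good set the collision functional of the stress mark is the sum over `(k, l)`
   of the collision sums `K_N[a_{kl} g Ξ_P^{kl}]` of `EvenStressEnskog`;
2. (parts A, C, `sum_enskog_integral_eq`) the summed Enskog predictions `Σ_{kl} σ³∫₀ᵗ∫ a_{kl} g Y B_r(Ξ_P^{kl})` equal
   `2∫₀ᵗ∫ g (p_hs − ρ_rθ_r) tr a + (8π/15) ∫₀ᵗ∫ (σ³ρ_r)⁺ g Ỹ (a⁰ : P_r)` — the Enskog tensor identity (landed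
   `ChaosClosesEulerEnskogTensor.stub_enskogTensorIdentity`), `tr P_r = 3ρ_rθ_r` identically, and
   `p_hs − ρθ = σ³ρ²θ f_ex′(σ³ρ)` by DEFINITION of `hsCompressibility`; `Ỹ = (3/2π) F′ ∘ clamp` is the continuous band
   function of the PROVED support `HsEosLowDensity` (`hsEosLowDensity_proof`), equal to `Y` on `(0, η_A/2)`;
3. (this file, `measure_union_bound`) hence the event `{η < |D_CPV|}` is covered by the nine events
   `{η/18 < |D_ESE^{kl}|}`, the event `{15η/16π < |W|}` and the null bad set: nine instances of `EvenStressEnskog`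
   (weights `χ = a_{kl}`) and one of the weak isotropy (traceless field `a⁰`, cut-off `b⁺ g Ỹ`), thresholds
   `η₀ := min(η₀ᴱ, η₀ᵂ, η_A/2)`, `σ₀ := min(σ₀ᴱ, σ₀ᵂ)`, `r₀ := min`, `N₀ := max`.  At `t = 0` the statistic vanishes off
   the null contact sets (`measure_cpv_zero`, `volume_contactSet`).

References: S. Chapman, T. G. Cowling, *The Mathematical Theory of Non-uniform Gases* (1970) §16.4; H. van Beijeren,
M. H. Ernst, Physica 68 (1973) 437; C. Cercignani, R. Illner, M. Pulvirenti (1994) §4.2.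
-/

noncomputable section

namespace Summit.AtomisticToContinuum.HydrodynamicLimit.Theorems.ParityBandClosurePressureValue

open scoped BigOperators Topology Classical MeasureTheory ENNReal InnerProductSpace
open Filter Set MeasureTheory
open Literature.MathematicalPhysics.KineticTheory
open Literature.Analysis.FluidPDE
open Summit.AtomisticToContinuum.HydrodynamicLimit.Theses

variable {N : ℕ}

/-! ## The union bound for one particle number -/

/-- **The union bound.**  If on the good set `K = Σ_{kl} E_{kl}` and `Σ_{kl} e_{kl} = 2 Pr + (8π/15) W`, then the event
`{η < |K − 2 Pr|}` is covered by the nine events `{η/18 < |E_{kl} − e_{kl}|}`, the event `{15η/16π < |W|}` and the null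
bad set of the flow (`localGibbsLaw_compl_good_eq_zero`). [folklore] -/
theorem measure_union_bound {σ : ℝ} (a₀ θ₀ : T3 → ℝ) (u₀ : T3 → V3) (N : ℕ)
    (Φ : HardSphereFlow (Torus.geometry (Fin 3)) (hsDiameter σ N) (N + 1))
    {K Pr W : Config (N + 1) (Fin 3) T3 → ℝ} {E e : Fin 3 → Fin 3 → Config (N + 1) (Fin 3) T3 → ℝ}
    (hK : ∀ z ∈ Φ.good, K z = ∑ k, ∑ l, E k l z)
    (he : ∀ z ∈ Φ.good, ∑ k, ∑ l, e k l z = 2 * Pr z + 8 * Real.pi / 15 * W z) (η : ℝ) :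
    localGibbsLaw σ a₀ u₀ θ₀ N Φ {z | η < |K z - 2 * Pr z|} ≤
      (∑ p : Fin 3 × Fin 3, localGibbsLaw σ a₀ u₀ θ₀ N Φ {z | η / 18 < |E p.1 p.2 z - e p.1 p.2 z|}) +
        localGibbsLaw σ a₀ u₀ θ₀ N Φ {z | 15 * η / (16 * Real.pi) < |W z|} := by
  set P := localGibbsLaw σ a₀ u₀ θ₀ N Φ with hP
  set Ev : Fin 3 × Fin 3 → Set (Config (N + 1) (Fin 3) T3) := fun p =>
    {z | η / 18 < |E p.1 p.2 z - e p.1 p.2 z|} with hEv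
  set F : Set (Config (N + 1) (Fin 3) T3) := {z | 15 * η / (16 * Real.pi) < |W z|} with hF
  have hsub : {z | η < |K z - 2 * Pr z|} ⊆ Φ.goodᶜ ∪ ((⋃ p ∈ (Finset.univ : Finset (Fin 3 × Fin 3)), Ev p) ∪ F) := by
    intro z hz
    by_cases hzg : z ∈ Φ.good
    · right
      by_contra hno
      have h1 : ∀ p : Fin 3 × Fin 3, |E p.1 p.2 z - e p.1 p.2 z| ≤ η / 18 :=
        fun p => not_lt.1 fun h => hno (Or.inl (mem_iUnion₂.2 ⟨p, Finset.mem_univ p, h⟩))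
      have h2 : |W z| ≤ 15 * η / (16 * Real.pi) := not_lt.1 fun h => hno (Or.inr h)
      have hid : K z - 2 * Pr z = ∑ k, ∑ l, (E k l z - e k l z) + 8 * Real.pi / 15 * W z := by
        simp only [Finset.sum_sub_distrib]
        rw [hK z hzg, he z hzg]
        ring
      have hsum : |∑ k, ∑ l, (E k l z - e k l z)| ≤ 9 * (η / 18) := by
        calc |∑ k, ∑ l, (E k l z - e k l z)|
            ≤ ∑ k, |∑ l, (E k l z - e k l z)| := Finset.abs_sum_le_sum_abs _ _
          _ ≤ ∑ k, ∑ l, |E k l z - e k l z| := Finset.sum_le_sum fun k _ => Finset.abs_sum_le_sum_abs _ _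
          _ ≤ ∑ _k : Fin 3, ∑ _l : Fin 3, η / 18 := Finset.sum_le_sum fun k _ => Finset.sum_le_sum fun l _ => h1 (k, l)
          _ = 9 * (η / 18) := by simp; ring
      have hpi : 8 * Real.pi / 15 * (15 * η / (16 * Real.pi)) = η / 2 := by
        field_simp
        ring
      have hbound : |K z - 2 * Pr z| ≤ η := by
        rw [hid]
        calc _ ≤ |∑ k, ∑ l, (E k l z - e k l z)| + |8 * Real.pi / 15 * W z| := abs_add_le _ _
          _ ≤ 9 * (η / 18) + 8 * Real.pi / 15 * (15 * η / (16 * Real.pi)) := by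
              refine add_le_add hsum ?_
              rw [abs_mul, abs_of_pos (by positivity : (0 : ℝ) < 8 * Real.pi / 15)]
              exact mul_le_mul_of_nonneg_left h2 (by positivity)
          _ = η := by rw [hpi]; ring
      exact absurd hz (not_lt.2 hbound)
    · exact Or.inl hzg
  calc P {z | η < |K z - 2 * Pr z|}
      ≤ P (Φ.goodᶜ ∪ ((⋃ p ∈ (Finset.univ : Finset (Fin 3 × Fin 3)), Ev p) ∪ F)) := measure_mono hsub
    _ ≤ P Φ.goodᶜ + P ((⋃ p ∈ (Finset.univ : Finset (Fin 3 × Fin 3)), Ev p) ∪ F) := measure_union_le _ _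
    _ = P ((⋃ p ∈ (Finset.univ : Finset (Fin 3 × Fin 3)), Ev p) ∪ F) := by
        rw [hP, localGibbsLaw_compl_good_eq_zero, zero_add]
    _ ≤ P (⋃ p ∈ (Finset.univ : Finset (Fin 3 × Fin 3)), Ev p) + P F := measure_union_le _ _
    _ ≤ (∑ p : Fin 3 × Fin 3, P (Ev p)) + P F := by
        gcongr
        exact measure_biUnion_finset_le _ _

/-! ## The instant `t = 0`: the statistic vanishes off the null contact sets -/

/-- Contact sets are null for the local Gibbs law (`≪` Liouville `≤` Lebesgue, `volume_contactSet`). [folklore] -/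
theorem localGibbsLaw_contactSet {σ : ℝ} (hσ : 0 < σ) (a₀ θ₀ : T3 → ℝ) (u₀ : T3 → V3) (N : ℕ)
    (Φ : HardSphereFlow (Torus.geometry (Fin 3)) (hsDiameter σ N) (N + 1)) {i j : Fin (N + 1)} (hij : i ≠ j) :
    localGibbsLaw σ a₀ u₀ θ₀ N Φ (contactSet (Torus.geometry (Fin 3)) (N + 1) (hsDiameter σ N) i j) = 0 := by
  rw [localGibbsLaw, particleLaw_eq]
  refine withDensity_absolutelyContinuous _ _ ?_
  rw [liouville_eq]
  exact le_antisymm ((Measure.le_iff'.1 Measure.restrict_le_self _).trans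
    (volume_contactSet (hsDiameter_pos hσ N).ne' hij).le) bot_le

/-- **At `t = 0` the event of `CollisionalPressureValueInBand` is null** (its statistic spelled out in the vocabulary
`mollDensity, mollTemperature`): a good datum outside every contact set has no collision at the instant `0`
(`Φ_0 = id`), so the collision functional over `[0, 0]` vanishes, as does the time integral over the null window; the
contact sets and the bad set are null. [folklore] -/
theorem measure_cpv_zero {σ r : ℝ} (hσ : 0 < σ) (a : Fin 3 → Fin 3 → ℝ × T3 → ℝ) (g : ℝ → ℝ)
    (a₀ θ₀ : T3 → ℝ) (u₀ : T3 → V3) (N : ℕ)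
    (Φ : HardSphereFlow (Torus.geometry (Fin 3)) (hsDiameter σ N) (N + 1)) {η : ℝ} (hη : 0 ≤ η) :
    localGibbsLaw σ a₀ u₀ θ₀ N Φ {z | η < |hsDiameter σ N / (N + 1 : ℝ) * ∑ᶠ (s : ℝ) (_ : s ∈ collisionTimes (Torus.geometry (Fin 3)) (hsDiameter σ N) (fun s => Φ.flow s z) ∩ Set.Icc 0 0), ∑ i : Fin (N + 1), ∑ j : Fin (N + 1), (if i ≠ j ∧ ‖(Torus.geometry (Fin 3)).sepVec (Φ.flow s z i).1 (Φ.flow s z j).1‖ = hsDiameter σ N then g (σ ^ 3 * mollDensity r (Φ.flow s z) (Φ.flow s z i).1) * |⟪(reflectVel ((Torus.geometry (Fin 3)).sepVec (Φ.flow s z i).1 (Φ.flow s z j).1) ((Φ.flow s z i).2, (Φ.flow s z j).2)).1 - (reflectVel ((Torus.geometry (Fin 3)).sepVec (Φ.flow s z i).1 (Φ.flow s z j).1) ((Φ.flow s z i).2, (Φ.flow s z j).2)).2, (hsDiameter σ N)⁻¹ • (Torus.geometry (Fin 3)).sepVec (Φ.flow s z i).1 (Φ.flow s z j).1⟫_ℝ|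 * ∑ k : Fin 3, ∑ l : Fin 3, a k l (s, (Φ.flow s z i).1) * (((hsDiameter σ N)⁻¹ • (Torus.geometry (Fin 3)).sepVec (Φ.flow s z i).1 (Φ.flow s z j).1) k * ((hsDiameter σ N)⁻¹ • (Torus.geometry (Fin 3)).sepVec (Φ.flow s z i).1 (Φ.flow s z j).1) l) else 0) - 2 * ∫ s in Set.Icc 0 0, ∫ x, g (σ ^ 3 * mollDensity r (Φ.flow s z) x) * (hsPressure σ (mollDensity r (Φ.flow s z) x) (mollTemperature r (Φ.flow s z) x) - mollDensity r (Φ.flow s z) x * mollTemperature r (Φ.flow s z) x) * ∑ k, a k k (s, x)|} = 0 := by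
  set S : Finset (Fin (N + 1) × Fin (N + 1)) := Finset.univ.filter fun p => p.1 ≠ p.2 with hS
  refine measure_mono_null (t := Φ.goodᶜ ∪ ⋃ p ∈ S, contactSet (Torus.geometry (Fin 3)) (N + 1) (hsDiameter σ N) p.1 p.2)
    ?_ (measure_union_null (localGibbsLaw_compl_good_eq_zero Φ)
      ((measure_biUnion_null_iff (Finset.countable_toSet S)).2 fun p hp =>
        localGibbsLaw_contactSet hσ a₀ θ₀ u₀ N Φ (Finset.mem_filter.1 hp).2))
  intro z hz
  by_cases hzg : z ∈ Φ.good
  · right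
    by_contra hno
    have hnc : ∀ i j : Fin (N + 1), i ≠ j → z ∉ contactSet (Torus.geometry (Fin 3)) (N + 1) (hsDiameter σ N) i j :=
      fun i j hij h => hno (mem_iUnion₂.2 ⟨(i, j), Finset.mem_filter.2 ⟨Finset.mem_univ _, hij⟩, h⟩)
    have hempty : collisionTimes (Torus.geometry (Fin 3)) (hsDiameter σ N) (fun s => Φ.flow s z) ∩ Icc 0 0 = ∅ := by
      ext s
      constructor
      · rintro ⟨⟨i, j, hij, hc⟩, hs0, hs1⟩
        obtain rfl : s = 0 := le_antisymm hs1 hs0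
        have hc' : z ∈ contactSet (Torus.geometry (Fin 3)) (N + 1) (hsDiameter σ N) i j := by
          have h' := hc
          simp only at h'
          rwa [Φ.flow_zero z hzg] at h'
        exact (hnc i j hij hc').elim
      · intro h
        exact h.elim
    have h0 : hsDiameter σ N / (N + 1 : ℝ) * ∑ᶠ (s : ℝ) (_ : s ∈ collisionTimes (Torus.geometry (Fin 3)) (hsDiameter σ N) (fun s => Φ.flow s z) ∩ Set.Icc 0 0), ∑ i : Fin (N + 1), ∑ j : Fin (N + 1), (if i ≠ j ∧ ‖(Torus.geometry (Fin 3)).sepVec (Φ.flow s z i).1 (Φ.flow s z j).1‖ = hsDiameter σ N then g (σ ^ 3 * mollDensity r (Φ.flow s z) (Φ.flow s z i).1) * |⟪(reflectVel ((Torus.geometry (Fin 3)).sepVec (Φ.flow s z i).1 (Φ.flow s z j).1) ((Φ.flow s z i).2, (Φ.flow s z j).2)).1 - (reflectVel ((Torus.geometry (Fin 3)).sepVec (Φ.flow s z i).1 (Φ.flow s z j).1) ((Φ.flow s z i).2, (Φ.flow s z j).2)).2, (hsDiameter σ N)⁻¹ • (Torus.geometry (Fin 3)).sepVec (Φ.flow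 s z i).1 (Φ.flow s z j).1⟫_ℝ| * ∑ k : Fin 3, ∑ l : Fin 3, a k l (s, (Φ.flow s z i).1) * (((hsDiameter σ N)⁻¹ • (Torus.geometry (Fin 3)).sepVec (Φ.flow s z i).1 (Φ.flow s z j).1) k * ((hsDiameter σ N)⁻¹ • (Torus.geometry (Fin 3)).sepVec (Φ.flow s z i).1 (Φ.flow s z j).1) l) else 0) - 2 * ∫ s in Set.Icc 0 0, ∫ x, g (σ ^ 3 * mollDensity r (Φ.flow s z) x) * (hsPressure σ (mollDensity r (Φ.flow s z) x) (mollTemperature r (Φ.flow s z) x) - mollDensity r (Φ.flow s z) x * mollTemperature r (Φ.flow s z) x) * ∑ k, a k k (s, x) = 0 := by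
      rw [hempty, finsum_mem_empty, mul_zero, Measure.restrict_eq_zero.2 (by simp), integral_zero_measure]
      ring
    rw [mem_setOf_eq, h0, abs_zero] at hz
    exact absurd hz (not_lt.2 hη)
  · exact Or.inl hzg

/-! ## Auxiliary test data -/

/-- The traceless part of a continuous matrix field is continuous. [folklore] -/
theorem continuous_traceless_field {a : Fin 3 → Fin 3 → ℝ × T3 → ℝ} (ha : ∀ j k, Continuous (a j k)) (j k : Fin 3) :
    Continuous fun p => a j k p - if j = k then (∑ i, a i i p) / 3 else 0 := by
  by_cases hjk : j = k
  · simp only [hjk, if_true]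
    exact (ha k k).sub ((continuous_finsetSum _ fun i _ => ha i i).div_const _)
  · simp only [hjk, if_false, sub_zero]
    exact ha j k

/-- Nine tolerances of `δ/10` and one more make `δ`. [folklore] -/
theorem sum_nine_add_one (δ : ℝ) (hδ : 0 ≤ δ) :
    (∑ _p : Fin 3 × Fin 3, ENNReal.ofReal (δ / 10)) + ENNReal.ofReal (δ / 10) = ENNReal.ofReal δ := by
  rw [← ENNReal.ofReal_sum_of_nonneg fun _ _ => by positivity, ← ENNReal.ofReal_add (by positivity) (by positivity)]
  congr 1
  simp only [Finset.sum_const, Finset.card_univ, Fintype.card_prod, Fintype.card_fin, nsmul_eq_mul]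
  push_cast
  ring

/-! ## The stub -/

/-- **STUB `stub_pressureValueOfEvenStress` of the line `Sketch` (crux `JParityClosure.ParityBandClosure`)**:
`EvenStressEnskog → WeakStressIsotropyInBand → CollisionalPressureValueInBand` (bodies of the two sister waypoints
expanded verbatim).  Proof: items 1–3 of the module docstring. [folklore] -/
theorem stub_pressureValueOfEvenStress :
    JParityClosure.EvenStressEnskog →
    (∃ η₀ : ℝ, 0 < η₀ ∧ ∀ (a₀ θ₀ : T3 → ℝ) (u₀ : T3 → V3), Continuous a₀ → Continuous θ₀ → Continuous u₀ →
    (∀ x, 0 < a₀ x) → (∀ x, 0 < θ₀ x) → ∃ σ₀ : ℝ, 0 < σ₀ ∧ ∀ σ : ℝ, 0 < σ → σ < σ₀ →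
    ∀ (T : ℝ) (ρ θ : ℝ → T3 → ℝ) (u : ℝ → T3 → V3), IsHardSphereEulerSolution σ T ρ u θ →
    ∀ Φ : (N : ℕ) → HardSphereFlow (Torus.geometry (Fin 3)) (hsDiameter σ N) (N + 1),
    TendstoHydroFieldsAt (fun N => localGibbsLaw σ a₀ u₀ θ₀ N (Φ N)) Φ ρ u θ 0 →
    ∀ t ∈ Set.Ico 0 T, ∀ a : Fin 3 → Fin 3 → ℝ × T3 → ℝ, (∀ j k, Continuous (a j k)) →
    (∀ p, ∑ j : Fin 3, a j j p = 0) →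
    ∀ g : ℝ → ℝ, Continuous g → (∀ b, η₀ ≤ b → g b = 0) →
    ∀ η δ : ℝ, 0 < η → 0 < δ → ∃ r₀ : ℝ, 0 < r₀ ∧ ∀ r : ℝ, 0 < r → r < r₀ → ∃ N₀ : ℕ, ∀ N : ℕ, N₀ ≤ N →
    let bx : T3 → T3 → ℝ := fun y x => 3 / (Real.pi * r ^ 3) * max (1 - Torus.euclidDist y x / r) 0
    let ρm : Config (N + 1) (Fin 3) T3 → T3 → ℝ := fun w x₀ => ∫ q, bx q.1 x₀ ∂(empiricalMeasure w)
    let mm : Config (N + 1) (Fin 3) T3 → T3 → V3 := fun w x₀ => ∫ q, bx q.1 x₀ • q.2 ∂(empiricalMeasure w)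
    let Pm : Config (N + 1) (Fin 3) T3 → T3 → Fin 3 → Fin 3 → ℝ := fun w x₀ j k =>
      (∫ q, bx q.1 x₀ * (q.2 j * q.2 k) ∂(empiricalMeasure w)) - mm w x₀ j * mm w x₀ k / ρm w x₀
    localGibbsLaw σ a₀ u₀ θ₀ N (Φ N)
      {z | η < |∫ s in Set.Icc 0 t, ∫ x, g (σ ^ 3 * ρm ((Φ N).flow s z) x) *
        ∑ j : Fin 3, ∑ k : Fin 3, a j k (s, x) * Pm ((Φ N).flow s z) x j k|} ≤ ENNReal.ofReal δ) →
    (∃ η₀ : ℝ, 0 < η₀ ∧ ∀ (a₀ θ₀ : T3 → ℝ) (u₀ : T3 → V3), Continuous a₀ → Continuous θ₀ → Continuous u₀ →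
    (∀ x, 0 < a₀ x) → (∀ x, 0 < θ₀ x) → ∃ σ₀ : ℝ, 0 < σ₀ ∧ ∀ σ : ℝ, 0 < σ → σ < σ₀ →
    ∀ (T : ℝ) (ρ θ : ℝ → T3 → ℝ) (u : ℝ → T3 → V3), IsHardSphereEulerSolution σ T ρ u θ →
    ∀ Φ : (N : ℕ) → HardSphereFlow (Torus.geometry (Fin 3)) (hsDiameter σ N) (N + 1),
    TendstoHydroFieldsAt (fun N => localGibbsLaw σ a₀ u₀ θ₀ N (Φ N)) Φ ρ u θ 0 →
    ∀ t ∈ Set.Ico 0 T, ∀ a : Fin 3 → Fin 3 → ℝ × T3 → ℝ, (∀ j k, Continuous (a j k)) →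
    (∀ j k p, a j k p = a k j p) →
    ∀ g : ℝ → ℝ, Continuous g → (∀ b, η₀ ≤ b → g b = 0) →
    ∀ η δ : ℝ, 0 < η → 0 < δ → ∃ r₀ : ℝ, 0 < r₀ ∧ ∀ r : ℝ, 0 < r → r < r₀ → ∃ N₀ : ℕ, ∀ N : ℕ, N₀ ≤ N →
    let ε := hsDiameter σ N
    let G : Geometry (Fin 3) T3 := Torus.geometry (Fin 3)
    let γ : Config (N + 1) (Fin 3) T3 → ℝ → Config (N + 1) (Fin 3) T3 := fun z s => (Φ N).flow s z
    let bx : T3 → T3 → ℝ := fun y x => 3 / (Real.pi * r ^ 3) * max (1 - Torus.euclidDist y x / r) 0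
    let ρm : Config (N + 1) (Fin 3) T3 → T3 → ℝ := fun w x₀ => ∫ q, bx q.1 x₀ ∂(empiricalMeasure w)
    let mm : Config (N + 1) (Fin 3) T3 → T3 → V3 := fun w x₀ => ∫ q, bx q.1 x₀ • q.2 ∂(empiricalMeasure w)
    let em : Config (N + 1) (Fin 3) T3 → T3 → ℝ := fun w x₀ =>
      ∫ q, bx q.1 x₀ * (‖q.2‖ ^ 2 / 2) ∂(empiricalMeasure w)
    let θm : Config (N + 1) (Fin 3) T3 → T3 → ℝ := fun w x₀ =>
      2 / 3 * (em w x₀ / ρm w x₀ - ‖mm w x₀‖ ^ 2 / (2 * ρm w x₀ ^ 2))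
    let pv : Config (N + 1) (Fin 3) T3 → ℝ → Fin (N + 1) → Fin (N + 1) → V3 × V3 := fun z s i j =>
      reflectVel (G.sepVec (γ z s i).1 (γ z s j).1) ((γ z s i).2, (γ z s j).2)
    let Kc : (Config (N + 1) (Fin 3) T3 → ℝ → Fin (N + 1) → Fin (N + 1) → ℝ) → Config (N + 1) (Fin 3) T3 → ℝ := fun F z =>
      ε / (N + 1 : ℝ) * ∑ᶠ (s : ℝ) (_ : s ∈ collisionTimes G ε (γ z) ∩ Set.Icc 0 t),
        ∑ i : Fin (N + 1), ∑ j : Fin (N + 1),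
          (if i ≠ j ∧ ‖G.sepVec (γ z s i).1 (γ z s j).1‖ = ε then F z s i j else 0)
    let D : Config (N + 1) (Fin 3) T3 → ℝ := fun z =>
      Kc (fun z s i j =>
          g (σ ^ 3 * ρm (γ z s) (γ z s i).1) *
            |⟪(pv z s i j).1 - (pv z s i j).2, ε⁻¹ • G.sepVec (γ z s i).1 (γ z s j).1⟫_ℝ| *
            ∑ k : Fin 3, ∑ l : Fin 3, a k l (s, (γ z s i).1) *
              ((ε⁻¹ • G.sepVec (γ z s i).1 (γ z s j).1) k * (ε⁻¹ • G.sepVec (γ z s i).1 (γ z s j).1) l)) z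
        - 2 * ∫ s in Set.Icc 0 t, ∫ x, g (σ ^ 3 * ρm (γ z s) x) *
            (hsPressure σ (ρm (γ z s) x) (θm (γ z s) x) - ρm (γ z s) x * θm (γ z s) x) *
            ∑ k : Fin 3, a k k (s, x)
    localGibbsLaw σ a₀ u₀ θ₀ N (Φ N) {z | η < |D z|} ≤ ENNReal.ofReal δ) := by
  intro hE hW
  obtain ⟨ηE, hηE, HE⟩ := hE
  obtain ⟨ηW, hηW, HW⟩ := hW
  obtain ⟨ηA, hηA, F, hFan, hFeq, -, -, -⟩ :=
    Summit.AtomisticToContinuum.HydrodynamicLimit.Theorems.hsEosLowDensity_proof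
  -- the continuous band function `Ỹ = (3/2π) F′ ∘ clamp`
  set Yt : ℝ → ℝ := fun b => 3 / (2 * Real.pi) * deriv F (max (min b (ηA / 2)) 0) with hYt_def
  have hclamp : ∀ b : ℝ, max (min b (ηA / 2)) 0 ∈ Ioo (-ηA) ηA := fun b =>
    ⟨lt_of_lt_of_le (by linarith) (le_max_right _ _), max_lt (lt_of_le_of_lt (min_le_right _ _) (by linarith)) hηA⟩
  have hYt : Continuous Yt := by
    refine continuous_const.mul ?_
    exact hFan.deriv.continuousOn.comp_continuous ((continuous_id.min continuous_const).max continuous_const) hclamp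
  have hYeq : ∀ b ∈ Ioo 0 (ηA / 2), Yt b = contactValue b := by
    intro b hb
    have hbA : b ∈ Ioo 0 ηA := ⟨hb.1, hb.2.trans (by linarith)⟩
    have hnhds : hsExcessFreeEnergy =ᶠ[𝓝 b] F :=
      Filter.eventuallyEq_of_mem (isOpen_Ioo.mem_nhds hbA) (hFeq.mono Ioo_subset_Ico_self)
    simp only [hYt_def, contactValue]
    rw [min_eq_left hb.2.le, max_eq_left hb.1.le, hnhds.deriv_eq]
  -- thresholds
  refine ⟨min ηE (min ηW (ηA / 2)), lt_min hηE (lt_min hηW (half_pos hηA)), ?_⟩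
  intro a₀ θ₀ u₀ ha₀ hθ₀ hu₀ ha₀p hθ₀p
  obtain ⟨σE, hσE, HE1⟩ := HE a₀ θ₀ u₀ ha₀ hθ₀ hu₀ ha₀p hθ₀p
  obtain ⟨σW, hσW, HW1⟩ := HW a₀ θ₀ u₀ ha₀ hθ₀ hu₀ ha₀p hθ₀p
  refine ⟨min σE σW, lt_min hσE hσW, ?_⟩
  intro σ hσ hσlt T ρ θ u hEul Φ hLLN t ht a ha _hasym g hg hg0 η δ hη hδ
  have hle : min ηE (min ηW (ηA / 2)) ≤ ηA / 2 := (min_le_right _ _).trans (min_le_right _ _)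
  have hg0E : ∀ b, ηE ≤ b → g b = 0 := fun b hb => hg0 b ((min_le_left _ _).trans hb)
  have hg0W : ∀ b, ηW ≤ b → g b = 0 := fun b hb => hg0 b (((min_le_right _ _).trans (min_le_left _ _)).trans hb)
  rcases (ht.1 : (0 : ℝ) ≤ t).eq_or_lt with h0 | htpos
  · -- the instant `t = 0`
    subst h0
    refine ⟨1, one_pos, fun r _ _ => ⟨0, fun N _ => ?_⟩⟩
    exact (measure_cpv_zero (r := r) hσ a g a₀ θ₀ u₀ N (Φ N) hη.le).trans_le bot_le
  · -- `0 < t`: nine instances of `EvenStressEnskog` and one of the weak isotropy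
    have hW2 := HW1 σ hσ (hσlt.trans_le (min_le_right _ _)) T ρ θ u hEul Φ hLLN t ht
      (fun j k p => a j k p - if j = k then (∑ i, a i i p) / 3 else 0) (continuous_traceless_field ha)
      (fun p => sum_traceless_diag fun j' k' => a j' k' p)
      (fun b => max b 0 * g b * Yt b) (((continuous_id.max continuous_const).mul hg).mul hYt)
      (fun b hb => by simp only [hg0W b hb, mul_zero, zero_mul])
      (15 * η / (16 * Real.pi)) (δ / 10) (by positivity) (by positivity)
    obtain ⟨rW, hrW, HW3⟩ := hW2
    have hE2 : ∀ p : Fin 3 × Fin 3, ∃ r₀ : ℝ, 0 < r₀ ∧ ∀ r : ℝ, 0 < r → r < r₀ → ∃ N₀ : ℕ, ∀ N : ℕ, N₀ ≤ N →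
        ∀ k l : Fin 3, localGibbsLaw σ a₀ u₀ θ₀ N (Φ N)
          {z | η / 18 < |evenStat σ N (Φ N) t (a p.1 p.2) g (evenMark k l) r z|} ≤ ENNReal.ofReal (δ / 10) :=
      fun p => HE1 σ hσ (hσlt.trans_le (min_le_left _ _)) Φ t htpos (a p.1 p.2) (ha p.1 p.2) g hg hg0E
        (η / 18) (δ / 10) (by positivity) (by positivity)
    choose rE hrE HE3 using hE2
    refine ⟨min rW (Finset.univ.inf' Finset.univ_nonempty rE),
      lt_min hrW ((Finset.lt_inf'_iff _).2 fun p _ => hrE p), ?_⟩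
    intro r hr hrlt
    have hrW' : r < rW := hrlt.trans_le (min_le_left _ _)
    have hrE' : ∀ p, r < rE p := fun p =>
      hrlt.trans_le ((min_le_right _ _).trans (Finset.inf'_le _ (Finset.mem_univ p)))
    obtain ⟨NW, HW4⟩ := HW3 r hr hrW'
    have hE4 : ∀ p : Fin 3 × Fin 3, ∃ N₀ : ℕ, ∀ N : ℕ, N₀ ≤ N → ∀ k l : Fin 3, localGibbsLaw σ a₀ u₀ θ₀ N (Φ N)
        {z | η / 18 < |evenStat σ N (Φ N) t (a p.1 p.2) g (evenMark k l) r z|} ≤ ENNReal.ofReal (δ / 10) :=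
      fun p => HE3 p r hr (hrE' p)
    choose NE HE5 using hE4
    refine ⟨max NW (Finset.univ.sup NE), fun N hN => ?_⟩
    have hNW : NW ≤ N := (le_max_left _ _).trans hN
    have hNE : ∀ p, NE p ≤ N := fun p => (Finset.le_sup (Finset.mem_univ p)).trans ((le_max_right _ _).trans hN)
    -- the union bound, fed with the mark matching (part B) and the deterministic identity (parts A, C)
    have key := measure_union_bound a₀ θ₀ u₀ N (Φ N)
      (fun z hz => cpvCollision_eq_sum hσ (Φ N) hz t a g r)
      (fun z hz => sum_enskog_integral_eq (t := t) hYeq hg0 hle (lt_min hηE (lt_min hηW (half_pos hηA))) hσ hr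
        ha hg hYt (Φ N) hz) η
    have bE : ∀ p : Fin 3 × Fin 3, localGibbsLaw σ a₀ u₀ θ₀ N (Φ N)
        {z | η / 18 < |evenStat σ N (Φ N) t (a p.1 p.2) g (evenMark p.1 p.2) r z|} ≤ ENNReal.ofReal (δ / 10) :=
      fun p => HE5 p N (hNE p) p.1 p.2
    refine key.trans ((add_le_add (Finset.sum_le_sum fun p _ => bE p) (HW4 N hNW)).trans ?_)
    exact (sum_nine_add_one δ hδ.le).le

end Summit.AtomisticToContinuum.HydrodynamicLimit.Theorems.ParityBandClosurePressureValue

end
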